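import Literature.Probability.RandomPlanarGeometry.LocalMartingaleProofs
import Literature.Probability.Process.SimpleProcessAlgebra
import HarnessLib

/-!
# Quadratic sums of elementary stochastic integrals against Brownian motion

Second-moment ("`L²`") control of the **quadratic variation sums** of an elementary stochastic
integral `M = H · B` of a bounded simple process `H` (`Literature.Probability.Process.SimpleProcess`) against the canonical
Brownian motion `B = Literature.brownian` on `(ℝ≥0 → ℝ, preWienerMeasure)` with its raw natural
filtration `𝓕⁰ = Literature.brownianFiltration`, along the (capped) partition `t ∧ tᵢ` of `H` itself:

* `integral_brownian_sub_pow_four` — `E[(B_t - B_s)⁴] = 3 (t - s)²`;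
* the centred squared increments `ξ = (B_u - B_s)² - (u - s)`: `E[ξ | 𝓕⁰_s] = 0`
  (`condExp_sqIncr`) and `E[ξ²] = 2 (u - s)²` (`integral_sqIncr_sq`);
* the orthogonality lemma `integral_mul_eq_zero_of_condExp_eq_zero`
  (`E[Y ξ] = 0` for `Y` measurable w.r.t. a σ-algebra given which `ξ` is centred);
* `SimpleProcess.integral_min_succ_sub` — over one of its own partition intervals the
  elementary integral moves by `Hᵢ (B_{t ∧ tᵢ₊₁} - B_{t ∧ tᵢ})`;
* the main estimate `sq_integral_weightedSqIncrSum_le`: for deterministic weights `|wᵢ| ≤ 1`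
  and `|Hᵢ| ≤ C`,
  `E[(∑ᵢ wᵢ Hᵢ² ((Δᵢ B)² - Δᵢ t))²] ≤ 2 C⁴ ∑ᵢ (Δᵢ t)²`
  (`Δᵢ` = increment over `(t ∧ tᵢ, t ∧ tᵢ₊₁]`), i.e. the weighted quadratic sums
  `∑ᵢ wᵢ (Δᵢ M)²` of `M = H · B` differ from `∑ᵢ wᵢ ∫ H² ds` over the cells by a centred error of
  variance `≤ 2 C⁴ · mesh · t` (`measure_weightedQuadSum_sub_ge_le`, Chebyshev form).

This is the elementary-integrand case of `⟨H · B⟩ = ∫ H² ds` in the Riemann-sum form of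
Revuz–Yor, Ch. IV, Thm (1.8) / Le Gall, Prop. 4.21, used in the proof of Itô's formula
(Le Gall, Thm 5.10, display (5.16)); everything is proved, for the raw filtration.

## References

* D. Revuz, M. Yor, *Continuous Martingales and Brownian Motion* (3rd ed., 1999), Ch. I,
  Thm (2.4) (`⟨B, B⟩_t = t`: by independence of the increments and `E[Y⁴] = 3 E[Y²]²` for a
  centred Gaussian `Y`, `E[(∑ₖ (X(Fₖ)² - μ(Fₖ)))²] = 2 ∑ₖ μ(Fₖ)²`); Ch. IV, Thm (1.8) (quadratic
  variation of continuous local martingales as the limit in probability of `∑ (Δᵢ M)²`),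
  Thm (2.2).
* J.-F. Le Gall, *Brownian Motion, Martingales, and Stochastic Calculus* (2016), Prop. 4.21,
  Thm 5.10.
-/

open MeasureTheory ProbabilityTheory Filter Finset
open scoped NNReal ENNReal Topology

noncomputable section

namespace Literature.Probability.Process

/-! ### Moments of Brownian increments -/

/-- **Fourth moment of Brownian increments**: `E[(B_t - B_s)⁴] = 3 (t - s)²`
(the increment is `𝓝(0, t - s)` and `∫ x⁴ d𝓝(0, v) = 3 v²`).
Revuz–Yor, *Continuous Martingales and Brownian Motion* (1999), Ch. I, proof of Thm (2.4)
(`E[Y⁴] = 3 E[Y²]²` for a centred Gaussian `Y`). [folklore] -/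
theorem integral_brownian_sub_pow_four (s t : ℝ≥0) :
    ∫ ω, (brownian t - brownian s) ω ^ 4 ∂preWienerMeasure = 3 * ((t : ℝ) - s) ^ 2 := by
  have hlaw := hasLaw_brownian_sub RandomPlanarGeometry.exists_isBrownianReal_measurable_continuous_holds t s
  have h := hlaw.integral_comp (f := fun x : ℝ ↦ x ^ 4) (by fun_prop)
  simp only [Function.comp_def] at h
  rw [h, integral_pow_four_gaussianReal, coe_nndist, Real.dist_eq, sq_abs]
  rfl

/-- Brownian increments have moments of all (finite) orders. [folklore] -/
theorem memLp_brownian_sub (s t : ℝ≥0) {p : ℝ≥0∞} (hp : p ≠ ∞) :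
    MemLp (brownian t - brownian s) p preWienerMeasure :=
  RandomPlanarGeometry.isPreBrownianReal_brownian.isGaussianProcess.hasGaussianLaw_sub.memLp hp

/-- The squared Brownian increment is square integrable. [folklore] -/
theorem memLp_two_brownian_sub_sq (s t : ℝ≥0) :
    MemLp (fun ω ↦ (brownian t - brownian s) ω ^ 2) 2 preWienerMeasure := by
  haveI : ENNReal.HolderTriple 4 4 2 := ⟨by
    rw [← two_mul, show (4 : ℝ≥0∞) = 2 * 2 by norm_num, ENNReal.mul_inv (by simp) (by simp),
      ← mul_assoc, ENNReal.mul_inv_cancel (by simp) (by simp), one_mul]⟩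
  have h4 : MemLp (brownian t - brownian s) 4 preWienerMeasure := memLp_brownian_sub s t (by simp)
  have := MemLp.mul' (r := 2) h4 h4
  simpa [sq] using this

/-- The **centred squared increment** `ξ = (B_u - B_s)² - (u - s)` is square integrable.
[folklore] -/
theorem memLp_two_sqIncr (s u : ℝ≥0) :
    MemLp (fun ω ↦ (brownian u - brownian s) ω ^ 2 - ((u : ℝ) - s)) 2 preWienerMeasure := by
  haveI := RandomPlanarGeometry.isProbabilityMeasure_preWienerMeasure'
  exact (memLp_two_brownian_sub_sq s u).sub (memLp_const _)

/-- The centred squared increment is integrable. [folklore] -/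
theorem integrable_sqIncr (s u : ℝ≥0) :
    Integrable (fun ω ↦ (brownian u - brownian s) ω ^ 2 - ((u : ℝ) - s)) preWienerMeasure := by
  haveI := RandomPlanarGeometry.isProbabilityMeasure_preWienerMeasure'
  exact (memLp_two_sqIncr s u).integrable one_le_two

/-- **The centred squared increment is conditionally centred**:
`E[(B_u - B_s)² - (u - s) | 𝓕⁰_s] = 0` for `s ≤ u`.
Revuz–Yor, *Continuous Martingales and Brownian Motion* (1999), Ch. II, Prop. (1.2)(ii).
[folklore] -/
theorem condExp_sqIncr {s u : ℝ≥0} (hsu : s ≤ u) :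
    preWienerMeasure[fun ω ↦ (brownian u - brownian s) ω ^ 2 - ((u : ℝ) - s) |
      RandomPlanarGeometry.brownianFiltration s] =ᵐ[preWienerMeasure] 0 := by
  haveI := RandomPlanarGeometry.isProbabilityMeasure_preWienerMeasure'
  have h1 := condExp_sub (RandomPlanarGeometry.memLp_two_brownian_sub s u).integrable_sq (integrable_const ((u : ℝ) - s))
    (RandomPlanarGeometry.brownianFiltration s) (μ := preWienerMeasure)
  have h2 := RandomPlanarGeometry.condExp_brownian_sub_sq hsu
  have h3 : preWienerMeasure[fun _ : ℝ≥0 → ℝ ↦ (u : ℝ) - s | RandomPlanarGeometry.brownianFiltration s] =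
      fun _ ↦ (u : ℝ) - s := condExp_const (RandomPlanarGeometry.brownianFiltration.le s) _
  have heq : (fun ω ↦ (brownian u - brownian s) ω ^ 2 - ((u : ℝ) - s)) =
      (fun ω ↦ (brownian u - brownian s) ω ^ 2) - fun _ ↦ (u : ℝ) - s := rfl
  rw [heq]
  filter_upwards [h1, h2] with ω hω hω'
  rw [hω, Pi.sub_apply, hω', h3, Pi.zero_apply, sub_self]

/-- **Second moment of the centred squared increment**: `E[((B_u - B_s)² - (u - s))²] = 2 (u - s)²`
for `s ≤ u` (`= 3Δ² - 2Δ·Δ + Δ²`).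
Revuz–Yor, *Continuous Martingales and Brownian Motion* (1999), Ch. I, proof of Thm (2.4).
[folklore] -/
theorem integral_sqIncr_sq {s u : ℝ≥0} (hsu : s ≤ u) :
    ∫ ω, ((brownian u - brownian s) ω ^ 2 - ((u : ℝ) - s)) ^ 2 ∂preWienerMeasure =
      2 * ((u : ℝ) - s) ^ 2 := by
  haveI := RandomPlanarGeometry.isProbabilityMeasure_preWienerMeasure'
  set D := brownian u - brownian s with hD
  set c : ℝ := (u : ℝ) - s with hc
  have h4 : Integrable (fun ω ↦ D ω ^ 4) preWienerMeasure := by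
    have := (memLp_two_brownian_sub_sq s u).integrable_sq
    refine this.congr (ae_of_all _ fun ω ↦ ?_)
    simp only [hD]
    ring
  have h2 : Integrable (fun ω ↦ D ω ^ 2) preWienerMeasure := (RandomPlanarGeometry.memLp_two_brownian_sub s u).integrable_sq
  have hexp : ∀ ω, (D ω ^ 2 - c) ^ 2 = (D ω ^ 4 - 2 * c * D ω ^ 2) + c ^ 2 := fun ω ↦ by ring
  simp_rw [hexp]
  have h42 : Integrable (fun ω ↦ D ω ^ 4 - 2 * c * D ω ^ 2) preWienerMeasure :=
    h4.sub (h2.const_mul (2 * c))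
  rw [integral_add h42 (integrable_const _), integral_sub h4 (h2.const_mul (2 * c)),
    integral_const_mul, integral_const, smul_eq_mul]
  simp only [probReal_univ, one_mul, hD, hc]
  rw [integral_brownian_sub_pow_four, RandomPlanarGeometry.integral_brownian_sub_sq hsu]
  ring

/-! ### Orthogonality of martingale differences -/

/-- **Orthogonality**: if `ξ` is integrable with `E[ξ | m] = 0` and `Y` is `m`-strongly measurable
with `Y ξ` integrable, then `E[Y ξ] = 0` (tower and pull-out properties).
Revuz–Yor, *Continuous Martingales and Brownian Motion* (1999), Ch. I, proof of Thm (2.4)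
(independence of the increments), and Ch. IV, proof of Thm (1.3), eq. (1.1). [folklore] -/
theorem integral_mul_eq_zero_of_condExp_eq_zero {Ω : Type*} {m m₀ : MeasurableSpace Ω}
    {μ : Measure Ω} [IsFiniteMeasure μ] (hm : m ≤ m₀) {Y ξ : Ω → ℝ}
    (hY : StronglyMeasurable[m] Y) (hYξ : Integrable (Y * ξ) μ) (hξ : Integrable ξ μ)
    (h0 : μ[ξ | m] =ᵐ[μ] 0) : ∫ ω, Y ω * ξ ω ∂μ = 0 := by
  have h1 : ∫ ω, (Y * ξ) ω ∂μ = ∫ ω, (μ[Y * ξ | m]) ω ∂μ := (integral_condExp hm).symm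
  have h2 := condExp_mul_of_stronglyMeasurable_left hY hYξ hξ (μ := μ)
  have h3 : ∫ ω, (μ[Y * ξ | m]) ω ∂μ = ∫ ω, (0 : ℝ) ∂μ := by
    refine integral_congr_ae ?_
    filter_upwards [h2, h0] with ω hω hω'
    rw [hω, Pi.mul_apply, hω', Pi.zero_apply, mul_zero]
  have : ∫ ω, Y ω * ξ ω ∂μ = ∫ ω, (Y * ξ) ω ∂μ := rfl
  rw [this, h1, h3, integral_zero]

/-! ### One cell: the weighted centred squared increment `c V² ξ` -/

section Cell

variable {a b : ℝ≥0} {V : (ℝ≥0 → ℝ) → ℝ} {C c : ℝ}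

/-- A cell term `c V² ((B_b - B_a)² - (b - a))` with `V` bounded and measurable is square
integrable. [folklore] -/
theorem memLp_two_cellTerm (hV : StronglyMeasurable[RandomPlanarGeometry.brownianFiltration a] V)
    (hVC : ∀ ω, |V ω| ≤ C) (hc : |c| ≤ 1) :
    MemLp (fun ω ↦ c * V ω ^ 2 * ((brownian b - brownian a) ω ^ 2 - ((b : ℝ) - a))) 2
      preWienerMeasure := by
  refine (memLp_two_sqIncr a b).of_le_mul (c := C ^ 2) ?_ (ae_of_all _ fun ω ↦ ?_)
  · exact ((stronglyMeasurable_const.mul ((hV.mono (RandomPlanarGeometry.brownianFiltration.le a)).pow 2)).mul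
      ((((stronglyMeasurable_brownian b).sub (stronglyMeasurable_brownian a)).pow 2).sub
        stronglyMeasurable_const)).aestronglyMeasurable
  · rw [Real.norm_eq_abs, Real.norm_eq_abs, abs_mul, abs_mul, abs_pow]
    have h1 : |c| * |V ω| ^ 2 ≤ 1 * C ^ 2 := by
      refine mul_le_mul hc ?_ (by positivity) zero_le_one
      exact pow_le_pow_left₀ (abs_nonneg _) (hVC ω) 2
    calc |c| * |V ω| ^ 2 * |(brownian b - brownian a) ω ^ 2 - ((b : ℝ) - a)|
        ≤ 1 * C ^ 2 * |(brownian b - brownian a) ω ^ 2 - ((b : ℝ) - a)| :=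
          mul_le_mul_of_nonneg_right h1 (abs_nonneg _)
      _ = C ^ 2 * |(brownian b - brownian a) ω ^ 2 - ((b : ℝ) - a)| := by rw [one_mul]

/-- The centred squared increment over `(a, b]` is `𝓕⁰_b`-strongly measurable. [folklore] -/
theorem stronglyMeasurable_sqIncr (hab : a ≤ b) :
    StronglyMeasurable[RandomPlanarGeometry.brownianFiltration b]
      (fun ω ↦ (brownian b - brownian a) ω ^ 2 - ((b : ℝ) - a)) :=
  (((RandomPlanarGeometry.stronglyAdapted_brownian b).sub
    ((RandomPlanarGeometry.stronglyAdapted_brownian a).mono (RandomPlanarGeometry.brownianFiltration.mono hab))).pow 2).sub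
    stronglyMeasurable_const

/-- A cell term is `𝓕⁰_b`-strongly measurable. [folklore] -/
theorem stronglyMeasurable_cellTerm (hab : a ≤ b) (hV : StronglyMeasurable[RandomPlanarGeometry.brownianFiltration a] V) :
    StronglyMeasurable[RandomPlanarGeometry.brownianFiltration b]
      (fun ω ↦ c * V ω ^ 2 * ((brownian b - brownian a) ω ^ 2 - ((b : ℝ) - a))) :=
  (stronglyMeasurable_const.mul ((hV.mono (RandomPlanarGeometry.brownianFiltration.mono hab)).pow 2)).mul
    (stronglyMeasurable_sqIncr hab)

/-- **Second moment of a cell term**: `E[(c V² ξ)²] ≤ C⁴ · 2 (b - a)²`. [folklore] -/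
theorem integral_cellTerm_sq_le (hab : a ≤ b) (hV : StronglyMeasurable[RandomPlanarGeometry.brownianFiltration a] V)
    (hVC : ∀ ω, |V ω| ≤ C) (hc : |c| ≤ 1) :
    ∫ ω, (c * V ω ^ 2 * ((brownian b - brownian a) ω ^ 2 - ((b : ℝ) - a))) ^ 2 ∂preWienerMeasure ≤
      C ^ 4 * (2 * ((b : ℝ) - a) ^ 2) := by
  rw [← integral_sqIncr_sq hab, ← integral_const_mul]
  refine integral_mono (memLp_two_cellTerm hV hVC hc).integrable_sq
    ((memLp_two_sqIncr a b).integrable_sq.const_mul _) fun ω ↦ ?_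
  dsimp only
  rw [mul_pow, mul_pow]
  refine mul_le_mul_of_nonneg_right ?_ (sq_nonneg _)
  have h1 : c ^ 2 ≤ 1 := by
    have := abs_le.1 hc
    nlinarith
  have h2 : (V ω ^ 2) ^ 2 ≤ C ^ 4 := by
    have hV' := abs_le.1 (hVC ω)
    have hC0 : 0 ≤ C := (abs_nonneg _).trans (hVC ω)
    have : V ω ^ 2 ≤ C ^ 2 := by nlinarith
    calc (V ω ^ 2) ^ 2 ≤ (C ^ 2) ^ 2 := pow_le_pow_left₀ (sq_nonneg _) this 2
      _ = C ^ 4 := by ring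
  calc c ^ 2 * (V ω ^ 2) ^ 2 ≤ 1 * C ^ 4 :=
        mul_le_mul h1 h2 (by positivity) zero_le_one
    _ = C ^ 4 := one_mul _

/-- **Orthogonality of a cell term to the past**: for `Y` square integrable and
`𝓕⁰_a`-strongly measurable, `E[Y · c V² ξ] = 0`.
Revuz–Yor, *Continuous Martingales and Brownian Motion* (1999), Ch. I, proof of Thm (2.4).
[folklore] -/
theorem integral_mul_cellTerm_eq_zero (hab : a ≤ b) (hV : StronglyMeasurable[RandomPlanarGeometry.brownianFiltration a] V)
    (hVC : ∀ ω, |V ω| ≤ C) {Y : (ℝ≥0 → ℝ) → ℝ}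
    (hY : StronglyMeasurable[RandomPlanarGeometry.brownianFiltration a] Y) (hY2 : MemLp Y 2 preWienerMeasure) :
    ∫ ω, Y ω * (c * V ω ^ 2 * ((brownian b - brownian a) ω ^ 2 - ((b : ℝ) - a)))
      ∂preWienerMeasure = 0 := by
  haveI := RandomPlanarGeometry.isProbabilityMeasure_preWienerMeasure'
  -- regroup as `(Y c V²) · ξ`
  have hre : ∀ ω, Y ω * (c * V ω ^ 2 * ((brownian b - brownian a) ω ^ 2 - ((b : ℝ) - a))) =
      (Y ω * (c * V ω ^ 2)) * ((brownian b - brownian a) ω ^ 2 - ((b : ℝ) - a)) := fun ω ↦ by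
    ring
  simp_rw [hre]
  have hZ : StronglyMeasurable[RandomPlanarGeometry.brownianFiltration a] (fun ω ↦ Y ω * (c * V ω ^ 2)) :=
    hY.mul (stronglyMeasurable_const.mul (hV.pow 2))
  have hZ2 : MemLp (fun ω ↦ Y ω * (c * V ω ^ 2)) 2 preWienerMeasure := by
    refine hY2.of_le_mul (c := |c| * C ^ 2) (hZ.mono (RandomPlanarGeometry.brownianFiltration.le a)).aestronglyMeasurable
      (ae_of_all _ fun ω ↦ ?_)
    rw [Real.norm_eq_abs, Real.norm_eq_abs, abs_mul, abs_mul, abs_pow, mul_comm]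
    refine mul_le_mul_of_nonneg_right (mul_le_mul_of_nonneg_left ?_ (abs_nonneg _)) (abs_nonneg _)
    exact pow_le_pow_left₀ (abs_nonneg _) (hVC ω) 2
  refine integral_mul_eq_zero_of_condExp_eq_zero (RandomPlanarGeometry.brownianFiltration.le a) hZ ?_
    (integrable_sqIncr a b) (condExp_sqIncr hab)
  exact hZ2.integrable_mul (memLp_two_sqIncr a b)

end Cell

/-! ### Increments of an elementary integral over its own partition intervals -/

namespace SimpleProcess

variable {Ω : Type*} {m : MeasurableSpace Ω} {𝓕 : Filtration ℝ≥0 m}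

/-- Over one of its own (capped) partition intervals `(t ∧ tᵢ, t ∧ tᵢ₊₁]` the elementary integral
`H · B` moves by `Hᵢ (B_{t ∧ tᵢ₊₁} - B_{t ∧ tᵢ})` (only the `i`-th summand changes).
Revuz–Yor, *Continuous Martingales and Brownian Motion* (1999), Ch. IV, §2, after Def. (2.3).
[folklore] -/
theorem integral_min_succ_sub (R : SimpleProcess m 𝓕) (B : ℝ≥0 → Ω → ℝ) {i : ℕ}
    (hi : i + 1 < R.times.length) (t : ℝ≥0) (ω : Ω) :
    R.integral B (min t (R.time (i + 1))) ω - R.integral B (min t (R.time i)) ω =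
      R.value i ω * (B (min t (R.time (i + 1))) ω - B (min t (R.time i)) ω) := by
  have hii : R.time i ≤ R.time (i + 1) := R.time_mono (Nat.le_succ i) hi
  rw [R.integral_apply_eq_sum_summand, R.integral_apply_eq_sum_summand, ← sum_sub_distrib]
  have hi' : i ∈ range (R.times.length - 1) := mem_range.2 (by omega)
  rw [sum_eq_single_of_mem i hi']
  · simp only [summand_apply]
    rw [min_assoc, min_self, min_assoc, min_eq_right hii, min_assoc, min_eq_left hii, min_assoc,
      min_self, sub_self, mul_zero, sub_zero]
  · intro j hj hji
    simp only [summand_apply]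
    rcases lt_or_gt_of_ne hji with h | h
    · -- `j < i`: both readings see the whole interval `(tⱼ, tⱼ₊₁] ∩ [0, t]`
      have hj1 : R.time (j + 1) ≤ R.time i := R.time_mono (Nat.succ_le_of_lt h) (by omega)
      have hj0 : R.time j ≤ R.time i := R.time_mono h.le (by omega)
      rw [min_assoc, min_eq_right (hj1.trans hii), min_assoc, min_eq_right (hj0.trans hii),
        min_assoc, min_eq_right hj1, min_assoc, min_eq_right hj0, sub_self]
    · -- `j > i`: both readings are before `tⱼ`
      have hj' : j + 1 < R.times.length := by have := mem_range.1 hj; omega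
      have h1 : R.time (i + 1) ≤ R.time j := R.time_mono (Nat.succ_le_of_lt h) (by omega)
      have h2 : R.time j ≤ R.time (j + 1) := R.time_mono (Nat.le_succ j) hj'
      rw [min_eq_left ((min_le_right _ _).trans (h1.trans h2)),
        min_eq_left ((min_le_right _ _).trans h1),
        min_eq_left ((min_le_right _ _).trans (hii.trans (h1.trans h2))),
        min_eq_left ((min_le_right _ _).trans (hii.trans h1))]
      ring

end SimpleProcess

/-! ### The main estimate: weighted quadratic sums of `H · B` -/

/-- The partial sums over the first `n` cells of the weighted centred quadratic sum of
`sq_integral_weightedSqIncrSum_le` are square integrable, `𝓕⁰_{t ∧ tₙ}`-measurable, and have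
second moment at most `2 C⁴ ∑_{i < n} Δᵢ²` (induction on `n`: the new cell term is orthogonal to
the earlier partial sum, `integral_mul_cellTerm_eq_zero`, and has second moment `≤ 2 C⁴ Δₙ²`,
`integral_cellTerm_sq_le`).
Revuz–Yor, *Continuous Martingales and Brownian Motion* (1999), Ch. I, proof of Thm (2.4).
[folklore] -/
theorem weightedSqIncrSum_partial (R : SimpleProcess _ RandomPlanarGeometry.brownianFiltration) {C : ℝ}
    (hC : ∀ i ω, |R.value i ω| ≤ C) {w : ℕ → ℝ} (hw : ∀ i, |w i| ≤ 1) (t : ℝ≥0) {n : ℕ}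
    (hn : n ≤ R.times.length - 1) :
    MemLp (fun ω ↦ ∑ i ∈ range n, w i * R.value i ω ^ 2 *
        ((brownian (min t (R.time (i + 1))) - brownian (min t (R.time i))) ω ^ 2 -
          (((min t (R.time (i + 1)) : ℝ≥0) : ℝ) - (min t (R.time i) : ℝ≥0)))) 2 preWienerMeasure ∧
    StronglyMeasurable[RandomPlanarGeometry.brownianFiltration (min t (R.time n))]
      (fun ω ↦ ∑ i ∈ range n, w i * R.value i ω ^ 2 *
        ((brownian (min t (R.time (i + 1))) - brownian (min t (R.time i))) ω ^ 2 -
          (((min t (R.time (i + 1)) : ℝ≥0) : ℝ) - (min t (R.time i) : ℝ≥0)))) ∧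
    ∫ ω, (∑ i ∈ range n, w i * R.value i ω ^ 2 *
        ((brownian (min t (R.time (i + 1))) - brownian (min t (R.time i))) ω ^ 2 -
          (((min t (R.time (i + 1)) : ℝ≥0) : ℝ) - (min t (R.time i) : ℝ≥0)))) ^ 2
        ∂preWienerMeasure ≤
      2 * C ^ 4 * ∑ i ∈ range n,
        ((((min t (R.time (i + 1)) : ℝ≥0) : ℝ) - (min t (R.time i) : ℝ≥0))) ^ 2 := by
  haveI := RandomPlanarGeometry.isProbabilityMeasure_preWienerMeasure'
  -- the cell terms, their partial sums and the capped cell lengths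
  set T : ℕ → (ℝ≥0 → ℝ) → ℝ := fun i ω ↦ w i * R.value i ω ^ 2 *
    ((brownian (min t (R.time (i + 1))) - brownian (min t (R.time i))) ω ^ 2 -
      (((min t (R.time (i + 1)) : ℝ≥0) : ℝ) - (min t (R.time i) : ℝ≥0))) with hT
  set d : ℕ → ℝ := fun i ↦ (((min t (R.time (i + 1)) : ℝ≥0) : ℝ) - (min t (R.time i) : ℝ≥0))
    with hd
  -- claim, by induction on the number of cells
  suffices ∀ n, n ≤ R.times.length - 1 →
      MemLp (fun ω ↦ ∑ i ∈ range n, T i ω) 2 preWienerMeasure ∧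
      StronglyMeasurable[RandomPlanarGeometry.brownianFiltration (min t (R.time n))] (fun ω ↦ ∑ i ∈ range n, T i ω) ∧
      ∫ ω, (∑ i ∈ range n, T i ω) ^ 2 ∂preWienerMeasure ≤ 2 * C ^ 4 * ∑ i ∈ range n, d i ^ 2 from
    this _ hn
  clear hn n
  intro n
  induction n with
  | zero =>
    intro _
    simp only [range_zero, sum_empty]
    refine ⟨memLp_const 0, stronglyMeasurable_const, ?_⟩
    simp
  | succ n ih =>
    intro hn
    obtain ⟨hL2, hmeas, hbound⟩ := ih (by omega)
    have hn' : n + 1 < R.times.length := by omega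
    have hmono : R.time n ≤ R.time (n + 1) := R.time_mono (Nat.le_succ n) hn'
    simp only [sum_range_succ]
    by_cases hnt : R.time n ≤ t
    · -- genuine cell `(tₙ, t ∧ tₙ₊₁]`
      have ha : min t (R.time n) = R.time n := min_eq_right hnt
      have hab : R.time n ≤ min t (R.time (n + 1)) := le_min hnt hmono
      have hV : StronglyMeasurable[RandomPlanarGeometry.brownianFiltration (R.time n)] (R.value n) :=
        R.stronglyMeasurable_value (by omega)
      have hTn : T n = fun ω ↦ w n * R.value n ω ^ 2 *
          ((brownian (min t (R.time (n + 1))) - brownian (R.time n)) ω ^ 2 -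
            (((min t (R.time (n + 1)) : ℝ≥0) : ℝ) - (R.time n : ℝ≥0))) := by
        simp only [hT, ha]
      have hTL2 : MemLp (T n) 2 preWienerMeasure := by
        rw [hTn]; exact memLp_two_cellTerm hV (hC n) (hw n)
      have hTmeas : StronglyMeasurable[RandomPlanarGeometry.brownianFiltration (min t (R.time (n + 1)))] (T n) := by
        rw [hTn]; exact stronglyMeasurable_cellTerm hab hV
      rw [ha] at hmeas
      refine ⟨hL2.add hTL2, ?_, ?_⟩
      · exact (hmeas.mono (RandomPlanarGeometry.brownianFiltration.mono hab)).add hTmeas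
      · -- expand the square
        have hFT : Integrable (fun ω ↦ (∑ i ∈ range n, T i ω) * T n ω) preWienerMeasure :=
          hL2.integrable_mul hTL2
        have hexp : ∀ ω, (∑ i ∈ range n, T i ω + T n ω) ^ 2 =
            ((∑ i ∈ range n, T i ω) ^ 2 + 2 * ((∑ i ∈ range n, T i ω) * T n ω)) + T n ω ^ 2 :=
          fun ω ↦ by ring
        simp_rw [hexp]
        have hI1 : Integrable (fun ω ↦ (∑ i ∈ range n, T i ω) ^ 2 +
            2 * ((∑ i ∈ range n, T i ω) * T n ω)) preWienerMeasure :=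
          hL2.integrable_sq.add (hFT.const_mul 2)
        rw [integral_add hI1 hTL2.integrable_sq,
          integral_add hL2.integrable_sq (hFT.const_mul 2), integral_const_mul]
        have hcross : ∫ ω, (∑ i ∈ range n, T i ω) * T n ω ∂preWienerMeasure = 0 := by
          simp only [hTn]
          exact integral_mul_cellTerm_eq_zero hab hV (hC n) hmeas hL2
        have hsq : ∫ ω, T n ω ^ 2 ∂preWienerMeasure ≤ C ^ 4 * (2 * d n ^ 2) := by
          simp only [hTn, hd, ha]
          exact integral_cellTerm_sq_le hab hV (hC n) (hw n)
        rw [hcross, mul_zero, add_zero, mul_add]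
        linarith
    · -- empty cell: `t < tₙ ≤ tₙ₊₁`, the new term vanishes
      push Not at hnt
      have ha : min t (R.time n) = t := min_eq_left hnt.le
      have hb : min t (R.time (n + 1)) = t := min_eq_left (hnt.le.trans hmono)
      have hTn : T n = 0 := by
        ext ω
        show w n * R.value n ω ^ 2 * ((brownian (min t (R.time (n + 1))) -
          brownian (min t (R.time n))) ω ^ 2 - ((((min t (R.time (n + 1))) : ℝ≥0) : ℝ) -
            (min t (R.time n) : ℝ≥0))) = 0
        rw [ha, hb]
        simp
      have hdn : d n = 0 := by
        show (((min t (R.time (n + 1)) : ℝ≥0) : ℝ) - (min t (R.time n) : ℝ≥0)) = 0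
        rw [ha, hb, sub_self]
      rw [ha] at hmeas
      simp only [hTn, Pi.zero_apply, add_zero, hdn]
      refine ⟨hL2, ?_, ?_⟩
      · rw [hb]; exact hmeas
      · simpa using hbound

/-- **Second moment of the weighted centred quadratic sums of an elementary integral.** For a
bounded simple process `H` (`|Hᵢ| ≤ C`) on the Brownian filtration, deterministic weights
`|wᵢ| ≤ 1` and a horizon `t`, with `Δᵢ B = B_{t ∧ tᵢ₊₁} - B_{t ∧ tᵢ}` and
`Δᵢ = t ∧ tᵢ₊₁ - t ∧ tᵢ`,
`E[(∑ᵢ wᵢ Hᵢ² ((Δᵢ B)² - Δᵢ))²] ≤ 2 C⁴ ∑ᵢ Δᵢ²`: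
the summands are orthogonal (each is centred given `𝓕⁰_{t ∧ tᵢ}`, which contains the earlier
ones) and `E[(wᵢ Hᵢ² ξᵢ)²] ≤ C⁴ E[ξᵢ²] = 2 C⁴ Δᵢ²`. Since `Δᵢ (H · B) = Hᵢ Δᵢ B`
(`SimpleProcess.integral_min_succ_sub`), this controls `∑ᵢ wᵢ (Δᵢ (H · B))² - ∑ᵢ wᵢ Hᵢ² Δᵢ`.
Revuz–Yor, *Continuous Martingales and Brownian Motion* (1999), Ch. I, Thm (2.4) (the case
`H = 1`, `⟨B, B⟩_t = t`) and Ch. IV, Thm (1.8) (general continuous local martingales);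
Le Gall (2016), Prop. 4.21. [folklore] -/
theorem sq_integral_weightedSqIncrSum_le (R : SimpleProcess _ RandomPlanarGeometry.brownianFiltration) {C : ℝ}
    (hC : ∀ i ω, |R.value i ω| ≤ C) {w : ℕ → ℝ} (hw : ∀ i, |w i| ≤ 1) (t : ℝ≥0) :
    ∫ ω, (∑ i ∈ range (R.times.length - 1), w i * R.value i ω ^ 2 *
        ((brownian (min t (R.time (i + 1))) - brownian (min t (R.time i))) ω ^ 2 -
          (((min t (R.time (i + 1)) : ℝ≥0) : ℝ) - (min t (R.time i) : ℝ≥0)))) ^ 2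
        ∂preWienerMeasure ≤
      2 * C ^ 4 * ∑ i ∈ range (R.times.length - 1),
        ((((min t (R.time (i + 1)) : ℝ≥0) : ℝ) - (min t (R.time i) : ℝ≥0))) ^ 2 :=
  (weightedSqIncrSum_partial R hC hw t le_rfl).2.2

/-- The sum of the squared capped cell lengths is at most `mesh · t`:
`∑ᵢ (t ∧ tᵢ₊₁ - t ∧ tᵢ)² ≤ δ t` if every capped cell has length `≤ δ`. [folklore] -/
theorem SimpleProcess.sum_sq_cappedCell_le {Ω : Type*} {m : MeasurableSpace Ω}
    {𝓕 : Filtration ℝ≥0 m} (R : SimpleProcess m 𝓕) (t : ℝ≥0) {δ : ℝ} (hδ : 0 ≤ δ)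
    (hmesh : ∀ i, i + 1 < R.times.length →
      (((min t (R.time (i + 1)) : ℝ≥0) : ℝ) - (min t (R.time i) : ℝ≥0)) ≤ δ) :
    ∑ i ∈ range (R.times.length - 1),
        ((((min t (R.time (i + 1)) : ℝ≥0) : ℝ) - (min t (R.time i) : ℝ≥0))) ^ 2 ≤ δ * t := by
  have hnn : ∀ i ∈ range (R.times.length - 1),
      0 ≤ (((min t (R.time (i + 1)) : ℝ≥0) : ℝ) - (min t (R.time i) : ℝ≥0)) := by
    intro i hi
    have hi' : i + 1 < R.times.length := by have := mem_range.1 hi; omega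
    exact sub_nonneg.2 (NNReal.coe_le_coe.2 (min_le_min_left _ (R.time_mono (Nat.le_succ i) hi')))
  calc ∑ i ∈ range (R.times.length - 1),
        ((((min t (R.time (i + 1)) : ℝ≥0) : ℝ) - (min t (R.time i) : ℝ≥0))) ^ 2
      ≤ ∑ i ∈ range (R.times.length - 1),
          δ * ((((min t (R.time (i + 1)) : ℝ≥0) : ℝ) - (min t (R.time i) : ℝ≥0))) := by
        refine sum_le_sum fun i hi ↦ ?_
        have hi' : i + 1 < R.times.length := by have := mem_range.1 hi; omega
        rw [sq]
        exact mul_le_mul_of_nonneg_right (hmesh i hi') (hnn i hi)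
    _ = δ * ((((min t (R.time (R.times.length - 1))) : ℝ≥0) : ℝ) - (min t (R.time 0) : ℝ≥0)) := by
        rw [← mul_sum, sum_range_sub (fun i ↦ (((min t (R.time i)) : ℝ≥0) : ℝ))]
    _ ≤ δ * t := by
        refine mul_le_mul_of_nonneg_left ?_ hδ
        have h1 : (((min t (R.time (R.times.length - 1))) : ℝ≥0) : ℝ) ≤ t :=
          NNReal.coe_le_coe.2 (min_le_left _ _)
        have h2 : (0 : ℝ) ≤ (min t (R.time 0) : ℝ≥0) := NNReal.coe_nonneg _
        linarith

/-- **Chebyshev's inequality** from a second-moment bound: `μ {η ≤ |Y|} ≤ E[Y²] / η²`.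
[folklore] -/
theorem measure_ge_abs_le_integral_sq_div {Ω : Type*} {mΩ : MeasurableSpace Ω} {μ : Measure Ω}
    [IsFiniteMeasure μ] {Y : Ω → ℝ} (hY : MemLp Y 2 μ) {η : ℝ} (hη : 0 < η) :
    μ {ω | η ≤ |Y ω|} ≤ ENNReal.ofReal ((∫ ω, Y ω ^ 2 ∂μ) / η ^ 2) := by
  have hset : {ω | η ≤ |Y ω|} = {ω | η ^ 2 ≤ Y ω ^ 2} := by
    ext ω
    simp only [Set.mem_setOf_eq]
    rw [← sq_abs (Y ω), sq_le_sq₀ hη.le (abs_nonneg _)]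
  have h := mul_meas_ge_le_integral_of_nonneg (ae_of_all _ fun ω ↦ sq_nonneg (Y ω))
    hY.integrable_sq (η ^ 2)
  have hη2 : 0 < η ^ 2 := by positivity
  have hreal : μ.real {ω | η ^ 2 ≤ Y ω ^ 2} ≤ (∫ ω, Y ω ^ 2 ∂μ) / η ^ 2 := by
    rw [le_div_iff₀ hη2, mul_comm]
    exact h
  rw [hset, ← ofReal_measureReal]
  exact ENNReal.ofReal_le_ofReal hreal

/-- **Quadratic variation of an elementary integral along its own partition, Chebyshev form.**
For a bounded simple process `H` (`|Hᵢ| ≤ C`) on the Brownian filtration whose capped cells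
`t ∧ tᵢ₊₁ - t ∧ tᵢ` all have length `≤ δ`, deterministic weights `|wᵢ| ≤ 1` and `η > 0`,
`P {η ≤ |∑ᵢ wᵢ ((Δᵢ (H · B))² - Hᵢ² Δᵢ)|} ≤ 2 C⁴ δ t / η²`, where
`Δᵢ (H · B) = (H · B)_{t ∧ tᵢ₊₁} - (H · B)_{t ∧ tᵢ}` and `Δᵢ = t ∧ tᵢ₊₁ - t ∧ tᵢ`; note
`∑ᵢ wᵢ Hᵢ² Δᵢ = ∫₀ᵗ w H² ds` for the step weight `w`. This is the elementary case of
"`∑ (Δᵢ M)² → ⟨M, M⟩_t` in probability as the mesh tends to `0`".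
Revuz–Yor, *Continuous Martingales and Brownian Motion* (1999), Ch. I, Thm (2.4) (the case
`H = 1`) and Ch. IV, Thm (1.8); Le Gall (2016), Prop. 4.21. [folklore] -/
theorem measure_weightedQuadSum_sub_ge_le (R : SimpleProcess _ RandomPlanarGeometry.brownianFiltration) {C : ℝ}
    (hC : ∀ i ω, |R.value i ω| ≤ C) {w : ℕ → ℝ} (hw : ∀ i, |w i| ≤ 1) (t : ℝ≥0) {δ : ℝ}
    (hδ : 0 ≤ δ) (hmesh : ∀ i, i + 1 < R.times.length →
      (((min t (R.time (i + 1)) : ℝ≥0) : ℝ) - (min t (R.time i) : ℝ≥0)) ≤ δ)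
    {η : ℝ} (hη : 0 < η) :
    preWienerMeasure {ω | η ≤ |∑ i ∈ range (R.times.length - 1), w i *
        ((R.integral brownian (min t (R.time (i + 1))) ω -
            R.integral brownian (min t (R.time i)) ω) ^ 2 -
          R.value i ω ^ 2 * ((((min t (R.time (i + 1)) : ℝ≥0) : ℝ) - (min t (R.time i) : ℝ≥0))))|}
      ≤ ENNReal.ofReal (2 * C ^ 4 * δ * t / η ^ 2) := by
  haveI := RandomPlanarGeometry.isProbabilityMeasure_preWienerMeasure'
  obtain ⟨hL2, -, hbound⟩ := weightedSqIncrSum_partial R hC hw t le_rfl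
  -- the two sums agree pathwise
  have heq : ∀ ω, (∑ i ∈ range (R.times.length - 1), w i *
        ((R.integral brownian (min t (R.time (i + 1))) ω -
            R.integral brownian (min t (R.time i)) ω) ^ 2 -
          R.value i ω ^ 2 * ((((min t (R.time (i + 1)) : ℝ≥0) : ℝ) - (min t (R.time i) : ℝ≥0))))) =
      ∑ i ∈ range (R.times.length - 1), w i * R.value i ω ^ 2 *
        ((brownian (min t (R.time (i + 1))) - brownian (min t (R.time i))) ω ^ 2 -
          (((min t (R.time (i + 1)) : ℝ≥0) : ℝ) - (min t (R.time i) : ℝ≥0))) := by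
    intro ω
    refine sum_congr rfl fun i hi ↦ ?_
    have hi' : i + 1 < R.times.length := by have := mem_range.1 hi; omega
    rw [R.integral_min_succ_sub brownian hi' t ω, Pi.sub_apply]
    ring
  simp_rw [heq]
  refine (measure_ge_abs_le_integral_sq_div hL2 hη).trans (ENNReal.ofReal_le_ofReal ?_)
  refine div_le_div_of_nonneg_right (hbound.trans ?_) (by positivity)
  have := R.sum_sq_cappedCell_le t hδ hmesh
  have hC4 : 0 ≤ 2 * C ^ 4 := by
    have : 0 ≤ C := (abs_nonneg _).trans (hC 0 (fun _ ↦ 0))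
    positivity
  calc 2 * C ^ 4 * ∑ i ∈ range (R.times.length - 1),
        ((((min t (R.time (i + 1)) : ℝ≥0) : ℝ) - (min t (R.time i) : ℝ≥0))) ^ 2
      ≤ 2 * C ^ 4 * (δ * t) := mul_le_mul_of_nonneg_left this hC4
    _ = 2 * C ^ 4 * δ * t := by ring

end Literature.Probability.Process
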